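import Mathlib.Analysis.SpecialFunctions.Complex.Arg
import Mathlib.Analysis.SpecialFunctions.Complex.Log
import Mathlib.Analysis.SpecialFunctions.Trigonometric.Basic
import Mathlib.Analysis.Real.Pi.Bounds

/-!
# The angular squeeze `A_e : z = r e^{iθ} ↦ r e^{i(e + (1 - 2e/π) θ)}` of the closed upper half-plane
# (route `SAWReversalUpgrade`, helper for item `AttachmentExists`, stmt-CriticalPhenomena-18009)

The boundary attachment of the route squeezes the closed upper half-plane `ℍ̄ = {im ≥ 0}` into
the sector `{e ≤ arg ≤ π - e}` by the map
`A z = ‖z‖ · exp (i (e + (1 - 2e/π) arg z))`, `0 < e ≤ 1/2`.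
This file records its elementary properties, for an abstract function `A` satisfying the
defining formula: `A` preserves the norm, fixes `0`, is continuous and injective on `ℍ̄`, and
sends `ℍ̄ ∖ {0}` into the open half-plane.

Everything is elementary trigonometry (folklore).
-/

noncomputable section

namespace Summit.CriticalPhenomena.SAWScalingLimit.Theorems

open Set Filter Topology

variable {A : ℂ → ℂ} {e : ℝ}

/-- The angle of the squeeze written as a real number: the exponent
`I * (e + (1 - 2e/π) arg z)` equals `θ * I` with `θ = e + (1 - 2e/π) arg z`. [folklore] -/
theorem sqz_exponent_eq (e : ℝ) (z : ℂ) :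
    Complex.I * ((e : ℂ) + (1 - 2 * (e : ℂ) / (Real.pi : ℂ)) * (Complex.arg z : ℂ)) =
      ((e + (1 - 2 * e / Real.pi) * Complex.arg z : ℝ) : ℂ) * Complex.I := by
  push_cast
  ring

/-- The squeeze in polar form: `A z = ‖z‖ · (cos θ + sin θ · I)` with
`θ = e + (1 - 2e/π) arg z`. [folklore] -/
theorem sqz_eq_polar
    (hA : ∀ z, A z = (‖z‖ : ℂ) * Complex.exp (Complex.I * ((e : ℂ) +
      (1 - 2 * (e : ℂ) / (Real.pi : ℂ)) * (Complex.arg z : ℂ)))) (z : ℂ) :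
    A z = (‖z‖ : ℂ) * (Complex.cos ((e + (1 - 2 * e / Real.pi) * Complex.arg z : ℝ) : ℂ) +
      Complex.sin ((e + (1 - 2 * e / Real.pi) * Complex.arg z : ℝ) : ℂ) * Complex.I) := by
  rw [hA z, sqz_exponent_eq, Complex.exp_mul_I]

/-- The squeezed angle of a point of the closed upper half-plane lies in `[e, π - e]`.
[folklore] -/
theorem sqz_angle_mem (he0 : 0 < e) (he1 : e ≤ 1 / 2) {z : ℂ} (hz : 0 ≤ z.im) :
    e ≤ e + (1 - 2 * e / Real.pi) * Complex.arg z ∧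
      e + (1 - 2 * e / Real.pi) * Complex.arg z ≤ Real.pi - e := by
  have hπ : 3 < Real.pi := Real.pi_gt_three
  have harg0 : 0 ≤ Complex.arg z := Complex.arg_nonneg_iff.2 hz
  have hargπ : Complex.arg z ≤ Real.pi := Complex.arg_le_pi z
  have hc : 0 ≤ 1 - 2 * e / Real.pi := by
    rw [sub_nonneg, div_le_one (by linarith)]
    linarith
  refine ⟨le_add_of_nonneg_right (mul_nonneg hc harg0), ?_⟩
  have h1 : (1 - 2 * e / Real.pi) * Complex.arg z ≤ (1 - 2 * e / Real.pi) * Real.pi :=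
    mul_le_mul_of_nonneg_left hargπ hc
  have h2 : (1 - 2 * e / Real.pi) * Real.pi = Real.pi - 2 * e := by
    field_simp
  linarith [he0]

/-- The squeezed angle lies in `(0, π)`. [folklore] -/
theorem sqz_angle_mem_Ioo (he0 : 0 < e) (he1 : e ≤ 1 / 2) {z : ℂ} (hz : 0 ≤ z.im) :
    0 < e + (1 - 2 * e / Real.pi) * Complex.arg z ∧
      e + (1 - 2 * e / Real.pi) * Complex.arg z < Real.pi := by
  obtain ⟨h1, h2⟩ := sqz_angle_mem he0 he1 hz
  exact ⟨he0.trans_le h1, by linarith⟩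

/-- **The squeeze preserves the norm**: `‖A z‖ = ‖z‖`. [folklore] -/
theorem sqz_norm
    (hA : ∀ z, A z = (‖z‖ : ℂ) * Complex.exp (Complex.I * ((e : ℂ) +
      (1 - 2 * (e : ℂ) / (Real.pi : ℂ)) * (Complex.arg z : ℂ)))) (z : ℂ) :
    ‖A z‖ = ‖z‖ := by
  rw [hA z, sqz_exponent_eq, norm_mul, Complex.norm_exp_ofReal_mul_I, mul_one,
    Complex.norm_real, Real.norm_eq_abs, abs_norm]

/-- **The squeeze fixes the origin**: `A 0 = 0`. [folklore] -/
theorem sqz_zero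
    (hA : ∀ z, A z = (‖z‖ : ℂ) * Complex.exp (Complex.I * ((e : ℂ) +
      (1 - 2 * (e : ℂ) / (Real.pi : ℂ)) * (Complex.arg z : ℂ)))) :
    A 0 = 0 := by
  rw [hA 0, norm_zero, Complex.ofReal_zero, zero_mul]

/-- `A z = 0 ↔ z = 0` (norm preservation). [folklore] -/
theorem sqz_eq_zero_iff
    (hA : ∀ z, A z = (‖z‖ : ℂ) * Complex.exp (Complex.I * ((e : ℂ) +
      (1 - 2 * (e : ℂ) / (Real.pi : ℂ)) * (Complex.arg z : ℂ)))) (z : ℂ) :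
    A z = 0 ↔ z = 0 := by
  rw [← norm_eq_zero, sqz_norm hA, norm_eq_zero]

/-- **The argument of the squeezed point** is the squeezed angle (for `z ≠ 0` in `ℍ̄`).
[folklore] -/
theorem sqz_arg (he0 : 0 < e) (he1 : e ≤ 1 / 2)
    (hA : ∀ z, A z = (‖z‖ : ℂ) * Complex.exp (Complex.I * ((e : ℂ) +
      (1 - 2 * (e : ℂ) / (Real.pi : ℂ)) * (Complex.arg z : ℂ)))) {z : ℂ} (hz : 0 ≤ z.im)
    (hz0 : z ≠ 0) :
    Complex.arg (A z) = e + (1 - 2 * e / Real.pi) * Complex.arg z := by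
  obtain ⟨h1, h2⟩ := sqz_angle_mem_Ioo he0 he1 hz
  rw [sqz_eq_polar hA]
  exact Complex.arg_mul_cos_add_sin_mul_I (norm_pos_iff.2 hz0)
    ⟨by linarith [Real.pi_pos], h2.le⟩

/-- **The squeeze pushes `ℍ̄ ∖ {0}` into the open half-plane**: `0 < im (A z)`. [folklore] -/
theorem sqz_im_pos (he0 : 0 < e) (he1 : e ≤ 1 / 2)
    (hA : ∀ z, A z = (‖z‖ : ℂ) * Complex.exp (Complex.I * ((e : ℂ) +
      (1 - 2 * (e : ℂ) / (Real.pi : ℂ)) * (Complex.arg z : ℂ)))) {z : ℂ} (hz : 0 ≤ z.im)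
    (hz0 : z ≠ 0) :
    0 < (A z).im := by
  obtain ⟨h1, h2⟩ := sqz_angle_mem_Ioo he0 he1 hz
  rw [sqz_eq_polar hA]
  have hsin : 0 < Real.sin (e + (1 - 2 * e / Real.pi) * Complex.arg z) :=
    Real.sin_pos_of_pos_of_lt_pi h1 h2
  have hr : 0 < ‖z‖ := norm_pos_iff.2 hz0
  simp only [Complex.mul_im, Complex.ofReal_re, Complex.ofReal_im, Complex.add_re,
    Complex.add_im, Complex.mul_re, Complex.I_re, Complex.I_im, ← Complex.ofReal_cos,
    ← Complex.ofReal_sin, mul_zero, mul_one, zero_mul, sub_zero, add_zero, zero_add]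
  positivity

/-- The squeeze maps the closed half-plane into itself. [folklore] -/
theorem sqz_im_nonneg (he0 : 0 < e) (he1 : e ≤ 1 / 2)
    (hA : ∀ z, A z = (‖z‖ : ℂ) * Complex.exp (Complex.I * ((e : ℂ) +
      (1 - 2 * (e : ℂ) / (Real.pi : ℂ)) * (Complex.arg z : ℂ)))) {z : ℂ} (hz : 0 ≤ z.im) :
    0 ≤ (A z).im := by
  by_cases hz0 : z = 0
  · rw [hz0, sqz_zero hA, Complex.zero_im]
  · exact (sqz_im_pos he0 he1 hA hz hz0).le

/-- **The squeeze is injective on the closed half-plane** (norm and argument are recovered).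
[folklore] -/
theorem sqz_injOn (he0 : 0 < e) (he1 : e ≤ 1 / 2)
    (hA : ∀ z, A z = (‖z‖ : ℂ) * Complex.exp (Complex.I * ((e : ℂ) +
      (1 - 2 * (e : ℂ) / (Real.pi : ℂ)) * (Complex.arg z : ℂ)))) :
    InjOn A {z : ℂ | 0 ≤ z.im} := by
  intro z hz w hw hzw
  have hz' : 0 ≤ z.im := hz
  have hw' : 0 ≤ w.im := hw
  have hnorm : ‖z‖ = ‖w‖ := by rw [← sqz_norm hA z, ← sqz_norm hA w, hzw]
  by_cases hz0 : z = 0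
  · rw [hz0, norm_zero] at hnorm
    rw [hz0, (norm_eq_zero.1 hnorm.symm)]
  · have hw0 : w ≠ 0 := by
      intro hw0
      rw [hw0, norm_zero, norm_eq_zero] at hnorm
      exact hz0 hnorm
    have hπ : 3 < Real.pi := Real.pi_gt_three
    have hc : 0 < 1 - 2 * e / Real.pi := by
      rw [sub_pos, div_lt_one (by linarith)]
      linarith
    have harg : Complex.arg z = Complex.arg w := by
      have h := congrArg Complex.arg hzw
      rw [sqz_arg he0 he1 hA hz' hz0, sqz_arg he0 he1 hA hw' hw0, add_right_inj] at h
      exact mul_left_cancel₀ hc.ne' h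
    exact Complex.ext_norm_arg hnorm harg

/-- **The squeeze is continuous on the closed half-plane** (the argument is continuous on `ℍ̄`
away from `0`, where the norm factor vanishes). [folklore] -/
theorem sqz_continuousOn
    (hA : ∀ z, A z = (‖z‖ : ℂ) * Complex.exp (Complex.I * ((e : ℂ) +
      (1 - 2 * (e : ℂ) / (Real.pi : ℂ)) * (Complex.arg z : ℂ)))) :
    ContinuousOn A {z : ℂ | 0 ≤ z.im} := by
  intro z hz
  have hz' : 0 ≤ z.im := hz
  by_cases hz0 : z = 0
  · -- at the origin: `‖A w‖ = ‖w‖ → 0`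
    subst hz0
    rw [ContinuousWithinAt, sqz_zero hA]
    refine tendsto_nhdsWithin_of_tendsto_nhds ?_
    rw [tendsto_zero_iff_norm_tendsto_zero]
    simp_rw [sqz_norm hA]
    exact continuous_norm.tendsto' 0 0 norm_zero
  · -- away from the origin the argument is continuous within `ℍ̄`
    have harg : ContinuousWithinAt Complex.arg {z : ℂ | 0 ≤ z.im} z := by
      by_cases hs : z ∈ Complex.slitPlane
      · exact (Complex.continuousAt_arg hs).continuousWithinAt
      · have him : z.im = 0 := by
          rw [Complex.mem_slitPlane_iff, not_or] at hs
          simpa using hs.2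
        have hre : z.re < 0 := by
          rw [Complex.mem_slitPlane_iff, not_or, not_lt] at hs
          rcases hs.1.lt_or_eq with h | h
          · exact h
          · exact absurd (Complex.ext h (by simpa using him)) hz0
        exact Complex.continuousWithinAt_arg_of_re_neg_of_im_zero hre him
    have hfun : A = fun w => (‖w‖ : ℂ) * Complex.exp (Complex.I * ((e : ℂ) +
        (1 - 2 * (e : ℂ) / (Real.pi : ℂ)) * (Complex.arg w : ℂ))) := funext hA
    rw [hfun]
    refine ((Complex.continuous_ofReal.comp continuous_norm).continuousWithinAt).mul ?_
    refine (Complex.continuous_exp.continuousAt).comp_continuousWithinAt ?_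
    exact continuousWithinAt_const.mul (continuousWithinAt_const.add
      (continuousWithinAt_const.mul (Complex.continuous_ofReal.continuousAt.comp_continuousWithinAt
        harg)))

/-- The squeeze tends to infinity within `ℍ̄` at infinity within `ℍ̄` (norm preservation).
[folklore] -/
theorem sqz_tendsto_cocompact (he0 : 0 < e) (he1 : e ≤ 1 / 2)
    (hA : ∀ z, A z = (‖z‖ : ℂ) * Complex.exp (Complex.I * ((e : ℂ) +
      (1 - 2 * (e : ℂ) / (Real.pi : ℂ)) * (Complex.arg z : ℂ)))) :
    Tendsto A (cocompact ℂ ⊓ 𝓟 {z : ℂ | 0 ≤ z.im}) (cocompact ℂ ⊓ 𝓟 {z : ℂ | 0 ≤ z.im}) := by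
  refine tendsto_inf.2 ⟨?_, ?_⟩
  · rw [← Metric.cobounded_eq_cocompact, ← comap_norm_atTop, tendsto_comap_iff]
    have h : Tendsto (fun z : ℂ => ‖z‖) (comap norm atTop ⊓ 𝓟 {z : ℂ | 0 ≤ z.im}) atTop :=
      tendsto_comap.mono_left inf_le_left
    refine h.congr' (Eventually.of_forall fun z => ?_)
    simp only [Function.comp_apply, sqz_norm hA]
  · exact tendsto_principal.2 (mem_inf_of_right (mem_principal.2 fun z hz =>
      sqz_im_nonneg he0 he1 hA hz))

end Summit.CriticalPhenomena.SAWScalingLimit.Theorems
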